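import Literature.Computability.AlgebraicComplexity.VNCTwoProofs
import Literature.Computability.AlgebraicComplexity.BrentFormulaDepthCircuits
import HarnessLib

/-!
# The classes `VNC_k` and the collapse `VF = VNC_1 ⊆ VNC_2 = VNC_3 = ⋯ = VP`
# (Bürgisser 2024 survey, Def. 2.11 and Cor. 2.14) — definition + PROOFS

Topic `Computability/AlgebraicComplexity`. Cell `val-lit`, row Bur2024-A (Bürgisser 2024 survey
*Completeness classes in algebraic complexity theory*, arXiv:2406.06217), §2.2 (held text
`paper:arxiv-2406.06217`, p0006 L99–L111, p0007 L27–L44):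

> **Definition 2.11.** The complexity class `VNC_k^𝔽` is defined as the set of sequences
> `(f_n)_{n ∈ ℕ}` of multivariate polynomials over `𝔽` such that there exists a sequence `(Φ_n)` of
> multiplicatively disjoint arithmetic circuits over `𝔽` such that `Φ_n` computes `f_n`, the size
> `|Φ_n|` is bounded by a polynomial in `n`, and the depth satisfies `D(Φ_n) = O(log^k n)`.
> Surprisingly, the hierarchy `VNC_1 ⊆ VNC_2 ⊆ … ⊆ VP` collapses. […]
> **Corollary 2.14.** Over any field `𝔽` we have `VF = VNC_1` and `VNC_2 = VNC_3 = ⋯ = VP`.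
> *Proof.* 1. To show the inclusion `VNC_1 ⊆ VF`, we transform circuits into formulas by preserving
> the depth […] and then use that `|Φ| ≤ 2^{D(Φ)} − 1` for every formula `Φ`. The reverse inclusion
> is a consequence of Theorem 2.7 (Brent). 2. This is a consequence of Theorem 2.12 (VSBR). □

Rendering (the convention of the tree's `VNCTwo.lean`, which states `VP ⊆ VNC²` = BCS 1997
Cor. (21.38) without introducing the class): a family `f = (f_n)`, `f_n ∈ k[σ_n]`, is in `VNC_d`
(`IsVNCFamily d f`) iff it is a p-family (BCS Def. (21.37) asks for p-families; the survey's
multiplicatively disjoint circuits of polynomial size have polynomially bounded degree, Rem. 2.10)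
and there are a constant `c` and a p-bounded `s` such that every `f_n` is computed by a fan-in-two
`ArithCircuit` (`ArithCircuit.lean`; depth = `ArithCircuit.depth` of `CircuitDepth.lean`) of size
`≤ s n` and depth `≤ c · (⌊log₂ n⌋ + 1)^d` ("`O(log^d n)`" for ALL `n` with one constant, the finitely
many small `n` being absorbed since `(⌊log₂ n⌋ + 1)^d ≥ 1`). `VF` is rendered, as elsewhere in the
tree (`BLMW11FormulasWeaklySkew.lean`, `PermanentAsCoefficient.lean`), by a p-bounded formula size
`E(f_n) = formulaComplexity f_n` (plus, for the class statement, the p-family condition).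

* `IsVNCFamily d f` — **Def. 2.11 / BCS (21.37)** (the only definition of this file);
* `IsVNCFamily.mono` (`VNC_d ⊆ VNC_e` for `d ≤ e`), `IsVNCFamily.isVPFamily` (`VNC_d ⊆ VP`);
* `IsVPFamily.isVNCFamily_two` (`VP ⊆ VNC_2`, the tree's
  `DepthReduction.exists_isPBounded_size_depth_le_of_isVPFamily` = BCS Cor. (21.38), any
  commutative semiring), **`isVNCFamily_iff_isVPFamily`** (**Cor. 2.14 (2)**: `VNC_d = VP` for
  every `d ≥ 2`);
* `IsVNCFamily.isPBounded_formulaComplexity` (`VNC_1 ⊆ VF`: `E(f) + 1 ≤ 2^{D}` for a fan-in-two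
  circuit of depth `D`, the tree's `formulaComplexity_succ_le_two_pow_depth`, and
  `2^{c(⌊log₂ n⌋+1)} ≤ (2n+2)^c`), `isVNCFamily_one_of_isPBounded_formulaComplexity` (`VF ⊆ VNC_1`:
  Brent's theorem in the tree, `WExpr.exists_depth_le_log` + `WExpr.exists_formula_depth_eq`, with
  `E(f_n) < 2^{(⌊log₂ n⌋+1)A}`), **`isVNCFamily_one_iff`** (**Cor. 2.14 (1)**: `VNC_1 = VF`);
* `ArithCircuit.exists_formula_depth_le_of_isFanInTwo` — **Cor. 2.13 (1)** ("a circuit of depth `D`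
  is simulated by a formula of the same depth", by recomputing shared results: unfold the circuit
  into its expression tree, `ArithCircuit.toWExpr` / `depth_toWExpr_le`, and realise the tree as a
  formula, `WExpr.exists_formula_depth_eq`; the size is then `< 2^D`).

All statements hold over every commutative semiring of coefficients (the survey: any field).
Honest framing: bookkeeping of Valiant's parallel classes from theorems already in the tree
(Brent, VSBR); nothing here bears on `VP` versus `VNP`; `VP ≠ VNP` is NOT proved.

## References

* [Burgisser2024Completeness] P. Bürgisser, arXiv:2406.06217 (2024), Def. 2.11 (p0006 L103–L109),
  Cor. 2.14 (p0007 L27–L44).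
* [BurgisserClausenShokrollahi1997] P. Bürgisser, M. Clausen, M. A. Shokrollahi, *Algebraic
  Complexity Theory*, Springer 1997, Def. (21.37), Cor. (21.38), Thm. (21.35) (Brent).
-/

noncomputable section

namespace Literature.Computability.AlgebraicComplexity

universe u v

variable {k : Type u} [CommSemiring k] {σ : ℕ → Type v} [∀ n, Fintype (σ n)]

/-- **Bürgisser 2024, Def. 2.11 / BCS 1997, Def. (21.37): the class `VNC_d`.** A family
`f = (f_n)` is in `VNC_d` iff it is a p-family and there are a constant `c` and a p-bounded size
function `s` such that every `f_n` is computed by a fan-in-two arithmetic circuit of size `≤ s n`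
and depth `≤ c · (⌊log₂ n⌋ + 1)^d` (depth `O(log^d n)`, size `n^{O(1)}`).
[cite: Burgisser2024Completeness, Def. 2.11 (p0006 L103–L109)] [cite: BurgisserClausenShokrollahi1997, Def. (21.37)] -/
def IsVNCFamily (d : ℕ) (f : ∀ n, MvPolynomial (σ n) k) : Prop :=
  IsPFamily f ∧ ∃ (c : ℕ) (s : ℕ → ℕ), IsPBounded s ∧ ∀ n : ℕ, ∃ P : ArithCircuit k (σ n),
    P.IsFanInTwo ∧ P.Computes (f n) ∧ P.size ≤ s n ∧ P.depth ≤ c * (Nat.log 2 n + 1) ^ d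

/-- `IsVNCFamily` unfolded. [cite: Burgisser2024Completeness, Def. 2.11 (p0006 L103–L109)] -/
theorem isVNCFamily_iff (d : ℕ) (f : ∀ n, MvPolynomial (σ n) k) :
    IsVNCFamily d f ↔ IsPFamily f ∧ ∃ (c : ℕ) (s : ℕ → ℕ), IsPBounded s ∧ ∀ n : ℕ,
      ∃ P : ArithCircuit k (σ n), P.IsFanInTwo ∧ P.Computes (f n) ∧ P.size ≤ s n ∧
        P.depth ≤ c * (Nat.log 2 n + 1) ^ d :=
  Iff.rfl

/-- **`VNC_d ⊆ VNC_e` for `d ≤ e`** (the hierarchy `VNC_1 ⊆ VNC_2 ⊆ …`).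
[cite: Burgisser2024Completeness, §2.2 (p0006 L111)] -/
theorem IsVNCFamily.mono {d e : ℕ} (hde : d ≤ e) {f : ∀ n, MvPolynomial (σ n) k}
    (hf : IsVNCFamily d f) : IsVNCFamily e f := by
  obtain ⟨hp, c, s, hs, h⟩ := hf
  refine ⟨hp, c, s, hs, fun n => ?_⟩
  obtain ⟨P, h2, hc, hsz, hd⟩ := h n
  exact ⟨P, h2, hc, hsz, hd.trans (Nat.mul_le_mul_left c
    (Nat.pow_le_pow_right (Nat.succ_pos _) hde))⟩

/-- **`VNC_d ⊆ VP`**: a p-family with fan-in-two circuits of p-bounded size is p-computable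
(`complexity ≤ size`). [cite: Burgisser2024Completeness, §2.2 (p0006 L99–L111)] -/
theorem IsVNCFamily.isVPFamily {d : ℕ} {f : ∀ n, MvPolynomial (σ n) k} (hf : IsVNCFamily d f) :
    IsVPFamily f := by
  obtain ⟨hp, c, s, hs, h⟩ := hf
  refine ⟨hp, hs.mono fun n => ?_⟩
  obtain ⟨P, h2, hc, hsz, -⟩ := h n
  exact (ArithCircuit.complexity_le_size h2 hc).trans hsz

/-- **`VP ⊆ VNC_2`** (BCS 1997, Cor. (21.38), via VSBR; the tree's
`DepthReduction.exists_isPBounded_size_depth_le_of_isVPFamily`), over every commutative semiring.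
[cite: Burgisser2024Completeness, Cor. 2.14 (2) (p0007 L32, L43)] [cite: BurgisserClausenShokrollahi1997, Cor. (21.38)] -/
theorem IsVPFamily.isVNCFamily_two {f : ∀ n, MvPolynomial (σ n) k} (hf : IsVPFamily f) :
    IsVNCFamily 2 f :=
  ⟨hf.1, DepthReduction.exists_isPBounded_size_depth_le_of_isVPFamily f hf⟩

/-- **Bürgisser 2024, Cor. 2.14 (2): `VNC_2 = VNC_3 = ⋯ = VP`** — for every `d ≥ 2`, a family is in
`VNC_d` iff it is in `VP` (over every commutative semiring; the survey: any field).
[cite: Burgisser2024Completeness, Cor. 2.14 (2) (p0007 L32, L43)] -/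
theorem isVNCFamily_iff_isVPFamily {d : ℕ} (hd : 2 ≤ d) (f : ∀ n, MvPolynomial (σ n) k) :
    IsVNCFamily d f ↔ IsVPFamily f :=
  ⟨IsVNCFamily.isVPFamily, fun h => (IsVPFamily.isVNCFamily_two h).mono hd⟩

/-- `2^{⌊log₂ n⌋ + 1} ≤ 2(n + 1)`. [cite: BurgisserClausenShokrollahi1997, Def. (21.37)] -/
private theorem two_pow_log_succ_le' (n : ℕ) : 2 ^ (Nat.log 2 n + 1) ≤ 2 * (n + 1) := by
  rcases Nat.eq_zero_or_pos n with rfl | hn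
  · simp
  · rw [pow_succ]
    have := Nat.pow_log_le_self 2 hn.ne'
    omega

/-- **`VNC_1 ⊆ VF`** (Cor. 2.14 (1), first inclusion): a fan-in-two circuit of depth `D` unfolds
to a formula of size `< 2^D` (`formulaComplexity_succ_le_two_pow_depth`), and
`2^{c(⌊log₂ n⌋+1)} ≤ (2n+2)^c` is p-bounded. [cite: Burgisser2024Completeness, Cor. 2.14 (1) (p0007 L30, L35–L39)] -/
theorem IsVNCFamily.isPBounded_formulaComplexity {f : ∀ n, MvPolynomial (σ n) k}
    (hf : IsVNCFamily 1 f) : IsPBounded fun n => formulaComplexity (f n) := by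
  obtain ⟨-, c, s, -, h⟩ := hf
  refine (IsPBounded.iff_exists_le_mul_succ_pow _).2 ⟨2 ^ c, c, fun n => ?_⟩
  obtain ⟨P, h2, hc, -, hd⟩ := h n
  rw [pow_one] at hd
  have h1 := formulaComplexity_succ_le_two_pow_depth h2
  rw [hc] at h1
  calc formulaComplexity (f n) ≤ 2 ^ P.depth := by omega
    _ ≤ 2 ^ (c * (Nat.log 2 n + 1)) := Nat.pow_le_pow_right (by norm_num) hd
    _ = (2 ^ (Nat.log 2 n + 1)) ^ c := by rw [← pow_mul, mul_comm]
    _ ≤ (2 * (n + 1)) ^ c := Nat.pow_le_pow_left (two_pow_log_succ_le' n) c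
    _ = 2 ^ c * (n + 1) ^ c := mul_pow _ _ _

/-- **`VF ⊆ VNC_1`** (Cor. 2.14 (1), second inclusion, Brent's theorem): a p-family with p-bounded
formula size has fan-in-two formulas of p-bounded size and depth `O(log n)` — rebalance an optimal
expression (`WExpr.exists_depth_le_log`: depth `≤ log₂ ((E+1)^8)`), realise it as a fan-in-two
formula of the same depth (`WExpr.exists_formula_depth_eq`), and use `E(f_n) + 1 ≤ 2^{(⌊log₂ n⌋+1)A}`.
[cite: Burgisser2024Completeness, Cor. 2.14 (1) (p0007 L30, L40–L41)] [cite: BurgisserClausenShokrollahi1997, Thm. (21.35) (Brent)] -/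
theorem isVNCFamily_one_of_isPBounded_formulaComplexity {f : ∀ n, MvPolynomial (σ n) k}
    (hp : IsPFamily f) (hE : IsPBounded fun n => formulaComplexity (f n)) : IsVNCFamily 1 f := by
  obtain ⟨A, -, hA⟩ := IsPBounded.exists_lt_two_pow hE
  refine ⟨hp, 8 * A, fun n => (formulaComplexity (f n) + 1) ^ 8,
    IsPBounded.pow_holds (IsPBounded.add_holds hE (IsPBounded.const 1)) 8, fun n => ?_⟩
  obtain ⟨e, he, hs⟩ := exists_wexpr_size_le_formulaComplexity (f n)
  obtain ⟨e', he', hd⟩ := e.exists_depth_le_log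
  obtain ⟨P, -, -, hP2, hPe, hPs, hPd⟩ := e'.exists_formula_depth_eq
  have hdepth : e'.depth ≤ Nat.log 2 ((formulaComplexity (f n) + 1) ^ 8) :=
    hd.trans (Nat.log_mono_right (Nat.pow_le_pow_left (Nat.succ_le_succ hs) 8))
  refine ⟨P, hP2, by rw [ArithCircuit.Computes, hPe, he', he], ?_, ?_⟩
  · -- size: `|P| ≤ |e'| < 2^{depth e'} ≤ (E + 1)^8`
    have h1 := e'.size_succ_le_two_pow_depth
    have h2 : 2 ^ e'.depth ≤ (formulaComplexity (f n) + 1) ^ 8 :=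
      (Nat.pow_le_pow_right (by norm_num) hdepth).trans
        (Nat.pow_log_le_self 2 (pow_ne_zero 8 (Nat.succ_ne_zero _)))
    show P.size ≤ (formulaComplexity (f n) + 1) ^ 8
    omega
  · -- depth: `log₂ ((E+1)^8) ≤ log₂ (2^{8A(⌊log₂ n⌋+1)}) = 8A(⌊log₂ n⌋+1)`
    rw [hPd, pow_one]
    refine hdepth.trans ?_
    have h3 : (formulaComplexity (f n) + 1) ^ 8 ≤ 2 ^ (8 * A * (Nat.log 2 n + 1)) := by
      calc (formulaComplexity (f n) + 1) ^ 8 ≤ (2 ^ ((Nat.log 2 n + 1) * A)) ^ 8 :=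
            Nat.pow_le_pow_left (Nat.succ_le_of_lt (hA n)) 8
        _ = 2 ^ (8 * A * (Nat.log 2 n + 1)) := by rw [← pow_mul]; congr 1; ring
    calc Nat.log 2 ((formulaComplexity (f n) + 1) ^ 8) ≤ Nat.log 2 (2 ^ (8 * A * (Nat.log 2 n + 1))) :=
          Nat.log_mono_right h3
      _ = 8 * A * (Nat.log 2 n + 1) := Nat.log_pow Nat.one_lt_two _

/-- **Bürgisser 2024, Cor. 2.14 (1): `VF = VNC_1`** — a family is in `VNC_1` iff it is a p-family of
p-bounded formula size (over every commutative semiring; the survey: any field).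
[cite: Burgisser2024Completeness, Cor. 2.14 (1) (p0007 L30, L35–L41)] -/
theorem isVNCFamily_one_iff (f : ∀ n, MvPolynomial (σ n) k) :
    IsVNCFamily 1 f ↔ IsPFamily f ∧ IsPBounded fun n => formulaComplexity (f n) :=
  ⟨fun h => ⟨h.1, h.isPBounded_formulaComplexity⟩,
    fun h => isVNCFamily_one_of_isPBounded_formulaComplexity h.1 h.2⟩

/-- **The collapse, as printed: `VNC_1 ⊆ VNC_2 ⊆ … ⊆ VP` and `VNC_1 ⊆ VP`**: every `VNC_1` family
(= `VF` family) is in `VNC_d` for all `d ≥ 1`, in particular in `VP = VNC_2`.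
[cite: Burgisser2024Completeness, §2.2 (p0006 L111) and Cor. 2.14] -/
theorem IsVNCFamily.of_one {d : ℕ} (hd : 1 ≤ d) {f : ∀ n, MvPolynomial (σ n) k}
    (hf : IsVNCFamily 1 f) : IsVNCFamily d f :=
  hf.mono hd

/-! ## Cor. 2.13 (1): circuits of depth `D` are simulated by formulas of depth `D` -/

/-- **Bürgisser 2024, Cor. 2.13 (1)**: "Suppose a polynomial `f` is computed by an arithmetic
circuit of depth `D`. Then `f` can be computed by an arithmetic formula of the same depth." ("This
is obtained by just recomputing results, ignoring a potential exponential increase in size.") In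
the tree's model: for every fan-in-two circuit `P` there is a well-formed fan-in-two FORMULA
computing `P.eval` of depth `≤ depth P` and size `< 2^{depth P}` — unfold `P` into its expression
tree (`ArithCircuit.toWExpr`, same value `eval_toWExpr`, depth `≤ depth P` by `depth_toWExpr_le`)
and realise the tree as a formula of the same depth (`WExpr.exists_formula_depth_eq`); a binary
tree of depth `D` has `< 2^D` nodes (`WExpr.size_succ_le_two_pow_depth`).
[cite: Burgisser2024Completeness, Cor. 2.13 (1) (p0007 L12–L14, L20)] -/
theorem ArithCircuit.exists_formula_depth_le_of_isFanInTwo {τ : Type v} (P : ArithCircuit k τ)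
    (h2 : P.IsFanInTwo) :
    ∃ Q : ArithCircuit k τ, Q.WellFormed ∧ Q.IsFormula ∧ Q.IsFanInTwo ∧ Q.eval = P.eval ∧
      Q.depth ≤ P.depth ∧ Q.size + 1 ≤ 2 ^ P.depth := by
  obtain ⟨Q, hw, hf, hQ2, he, hs, hd⟩ := P.toWExpr.exists_formula_depth_eq
  refine ⟨Q, hw, hf, hQ2, by rw [he, ArithCircuit.eval_toWExpr], ?_, ?_⟩
  · rw [hd]
    exact ArithCircuit.depth_toWExpr_le h2
  · calc Q.size + 1 ≤ P.toWExpr.size + 1 := Nat.succ_le_succ hs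
      _ ≤ 2 ^ P.toWExpr.depth := P.toWExpr.size_succ_le_two_pow_depth
      _ ≤ 2 ^ P.depth := Nat.pow_le_pow_right (by norm_num) (ArithCircuit.depth_toWExpr_le h2)

/-- Cor. 2.13 (1) for a polynomial: if `f` has a fan-in-two circuit of depth `≤ D` then it has a
fan-in-two formula of depth `≤ D` (and size `< 2^D`). [cite: Burgisser2024Completeness, Cor. 2.13 (1) (p0007 L12–L14)] -/
theorem exists_formula_of_circuit_depth_le {τ : Type v} {f : MvPolynomial τ k} {D : ℕ}
    (h : ∃ P : ArithCircuit k τ, P.IsFanInTwo ∧ P.Computes f ∧ P.depth ≤ D) :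
    ∃ Q : ArithCircuit k τ, Q.IsFormula ∧ Q.IsFanInTwo ∧ Q.Computes f ∧ Q.depth ≤ D ∧
      Q.size + 1 ≤ 2 ^ D := by
  obtain ⟨P, h2, hc, hD⟩ := h
  obtain ⟨Q, -, hf, hQ2, he, hd, hs⟩ := P.exists_formula_depth_le_of_isFanInTwo h2
  exact ⟨Q, hf, hQ2, by rw [ArithCircuit.Computes, he]; exact hc, hd.trans hD,
    hs.trans (Nat.pow_le_pow_right (by norm_num) hD)⟩

end Literature.Computability.AlgebraicComplexity

end
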